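import Literature.NumberTheory.EllipticCurves.TateSeriesFormal
import HarnessLib

/-!
# The quadratic coefficient of `q · j(q)`: `q · j(q) = 1 + 744 q + 196884 q² + ⋯`

Topic `Literature/NumberTheory/EllipticCurves`, namespace `Literature.NumberTheory.EllipticCurves`. Theorems
only (no definition, no named fact): the next coefficient of the tree's integer formal power series
`formalXJ = E₄³ · (Δ/q)⁻¹ ∈ ℤ⟦q⟧` (`TateSeriesFormal.lean`, which records `coeff 0 = 1`, `coeff 1 = 744`),

  `coeff_two_formalXJ : coeff 2 formalXJ = 196884`

(Nesterenko–Philippon LNM 1752 Ch. 2 Prop. 2.1 (3): `J(z) = 1/z + 744 + 196884 z + ⋯`; Serre, *Cours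
d'arithmétique* VII §3.3), from `E₄³ = 1 + 720 q + 179280 q² + ⋯`, `Δ/q = 1 − 24 q + 252 q² − ⋯`,
`(Δ/q)⁻¹ = 1 + 24 q + 324 q² + ⋯` and `179280 + 720·24 + 324 = 196884`, each coefficient computed from the
definitions (`coeff_two_mul`, binomial coefficients of `(1 − X)^{24}` and `(1 − X²)^{24}`).

Why (cell `bsd-2adic`, seat bsd-2adic-tower-1 GEN 8, scope memo HOME/tower/SCOPE-hNS2one-kernel-GEN8.md M3): the
unit part of the Tate parameter of `E/ℚ` at a place of multiplicative reduction above `2`, read modulo `8` from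
`q · j(q) = 1 + 744 q + 196884 q² + ⋯` and `j = c₄³/Δ`, needs `8 ∣ 744` AND `2 ∣ 196884` (the latter when
`ord₂ Δ = 1`).

## References
* [NesterenkoPhilippon2001] LNM 1752, Ch. 2, Prop. 2.1 (3), 2.2 (3), 2.3 (3).
* J.-P. Serre, *A Course in Arithmetic*, VII §3.3, §4.
-/

noncomputable section

open PowerSeries Finset
open scoped ArithmeticFunction.sigma

namespace Literature.NumberTheory.EllipticCurves

/-- `coeff 2 (φ ψ) = φ₀ ψ₂ + φ₁ ψ₁ + φ₂ ψ₀`. [folklore] -/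
private theorem coeff_two_mul (φ ψ : PowerSeries ℤ) :
    coeff 2 (φ * ψ) = coeff 0 φ * coeff 2 ψ + coeff 1 φ * coeff 1 ψ + coeff 2 φ * coeff 0 ψ := by
  rw [coeff_mul, Finset.Nat.antidiagonal_succ, Finset.sum_cons, Finset.Nat.antidiagonal_succ,
    Finset.map_cons, Finset.sum_cons, Finset.Nat.antidiagonal_zero, Finset.map_singleton,
    Finset.map_singleton, Finset.sum_singleton]
  simp only [Function.Embedding.coe_prodMap, Function.Embedding.coeFn_mk, Prod.map_apply,
    Nat.succ_eq_add_one, Function.Embedding.refl_apply, zero_add]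
  ring

/-- Coefficients `0, 1, 2` of `(1 − X)^k`: `1`, `−k`, `k(k−1)/2` (as `Nat.choose k 2`). [folklore] -/
private theorem coeff_two_one_sub_X_pow (k : ℕ) :
    coeff 2 ((1 - (X : PowerSeries ℤ)) ^ k) = (k.choose 2 : ℤ) := by
  induction k with
  | zero => simp [coeff_one]
  | succ k ih =>
    obtain ⟨h1, h0⟩ := coeff_one_one_sub_X_pow k
    rw [pow_succ, coeff_two_mul, ih, h1, h0, Nat.choose_succ_succ, Nat.choose_one_right]
    have e1 : coeff 1 (1 - (X : PowerSeries ℤ)) = -1 := by simp [coeff_one_X]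
    have e0 : coeff 0 (1 - (X : PowerSeries ℤ)) = 1 := by simp
    have e2 : coeff 2 (1 - (X : PowerSeries ℤ)) = 0 := by simp [coeff_X]
    rw [e0, e1, e2]; push_cast; ring

/-- Coefficients `0, 1, 2` of `(1 − X²)^k`: `1`, `0`, `−k`. [folklore] -/
private theorem coeff_le_two_one_sub_X_sq_pow (k : ℕ) :
    coeff 0 ((1 - (X : PowerSeries ℤ) ^ 2) ^ k) = 1 ∧ coeff 1 ((1 - (X : PowerSeries ℤ) ^ 2) ^ k) = 0 ∧
      coeff 2 ((1 - (X : PowerSeries ℤ) ^ 2) ^ k) = -(k : ℤ) := by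
  have e0 : coeff 0 (1 - (X : PowerSeries ℤ) ^ 2) = 1 := by simp
  have e1 : coeff 1 (1 - (X : PowerSeries ℤ) ^ 2) = 0 := by simp [coeff_X_pow, coeff_one]
  have e2 : coeff 2 (1 - (X : PowerSeries ℤ) ^ 2) = -1 := by simp [coeff_X_pow]
  induction k with
  | zero => simp [coeff_one]
  | succ k ih =>
    obtain ⟨h0, h1, h2⟩ := ih
    refine ⟨?_, ?_, ?_⟩
    · rw [pow_succ, coeff_zero_eq_constantCoeff_apply, map_mul, ← coeff_zero_eq_constantCoeff_apply,
        ← coeff_zero_eq_constantCoeff_apply, h0, e0, mul_one]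
    · rw [pow_succ, coeff_one_mul, h0, h1, e0, e1]; ring
    · rw [pow_succ, coeff_two_mul, h0, h1, h2, e0, e1, e2]; push_cast; ring

/-- `Δ/q = 1 − 24 q + 252 q² − ⋯`: the quadratic coefficient of `formalDeltaUnit` is
`C(24,2) − 24 = 276 − 24 = 252` (only the factors `(1 − q)²⁴ (1 − q²)²⁴` contribute).
[cite: NesterenkoPhilippon2001, Ch. 2, Prop. 2.2] -/
theorem coeff_two_formalDeltaUnit : coeff 2 formalDeltaUnit = 252 := by
  rw [coeff_formalDeltaUnit (le_refl 2), deltaFactorProd, Finset.prod_range_succ, Finset.prod_range_one,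
    zero_add, pow_one, coeff_two_mul]
  obtain ⟨h1, h0⟩ := coeff_one_one_sub_X_pow 24
  obtain ⟨g0, g1, g2⟩ := coeff_le_two_one_sub_X_sq_pow 24
  rw [h0, h1, coeff_two_one_sub_X_pow, g0, g1, g2]
  norm_num [Nat.choose]

/-- `(Δ/q)⁻¹ = 1 + 24 q + 324 q² + ⋯` (inverse of `Δ(z)/z = ∏ (1 − zⁿ)²⁴ = 1 − 24z + 252z² − ⋯`).
[cite: NesterenkoPhilippon2001, Ch. 2, Prop. 2.2] -/
theorem coeff_two_invOfUnit_formalDeltaUnit :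
    coeff 2 (PowerSeries.invOfUnit formalDeltaUnit 1) = 324 := by
  rw [coeff_invOfUnit, if_neg two_ne_zero, Finset.Nat.antidiagonal_succ, Finset.sum_cons,
    Finset.Nat.antidiagonal_succ, Finset.map_cons, Finset.sum_cons, Finset.Nat.antidiagonal_zero,
    Finset.map_singleton, Finset.map_singleton, Finset.sum_singleton]
  simp only [Function.Embedding.coe_prodMap, Function.Embedding.coeFn_mk, Prod.map_apply,
    Nat.succ_eq_add_one, Function.Embedding.refl_apply, zero_add]
  simp [coeff_one_formalDeltaUnit, coeff_two_formalDeltaUnit, coeff_one_invOfUnit_formalDeltaUnit]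

/-- `E₄³ = 1 + 720 q + 179280 q² + ⋯` (`E₄ = 1 + 240 q + 2160 q² + ⋯`, `σ₃(2) = 9`).
[cite: NesterenkoPhilippon2001, Ch. 2, Prop. 2.3] -/
theorem coeff_two_formalE4_pow_three : coeff 2 (formalE4 ^ 3) = 179280 := by
  have h0 : coeff 0 formalE4 = 1 := by
    rw [coeff_zero_eq_constantCoeff_apply, constantCoeff_formalE4]
  have h1 : coeff 1 formalE4 = 240 := by
    rw [coeff_formalE4, if_neg one_ne_zero, ArithmeticFunction.sigma_one]; norm_num
  have h2 : coeff 2 formalE4 = 2160 := by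
    rw [coeff_formalE4, if_neg two_ne_zero, ArithmeticFunction.sigma_apply, Nat.Prime.divisors Nat.prime_two,
      Finset.sum_pair (by decide : (1 : ℕ) ≠ 2)]
    norm_num
  have h00 : coeff 0 (formalE4 * formalE4) = 1 := by
    rw [coeff_zero_eq_constantCoeff_apply, map_mul, constantCoeff_formalE4, one_mul]
  have h01 : coeff 1 (formalE4 * formalE4) = 480 := by
    rw [coeff_one_mul, h0, h1]; norm_num
  have h02 : coeff 2 (formalE4 * formalE4) = 61920 := by
    rw [coeff_two_mul, h0, h1, h2]; norm_num
  rw [pow_succ, pow_two, coeff_two_mul, h00, h01, h02, h0, h1, h2]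
  norm_num

/-- **`q · j(q) = 1 + 744 q + 196884 q² + ⋯`**: the quadratic coefficient of `formalXJ` is `196884`
(Nesterenko–Philippon Ch. 2 Prop. 2.1 (3): `J(z) = 1/z + 744 + ∑ c(n) zⁿ`, `c(1) = 196884`).
[cite: NesterenkoPhilippon2001, Ch. 2, Prop. 2.1] -/
theorem coeff_two_formalXJ : coeff 2 formalXJ = 196884 := by
  have h0E : coeff 0 (formalE4 ^ 3) = 1 := by
    rw [coeff_zero_eq_constantCoeff_apply, map_pow, constantCoeff_formalE4, one_pow]
  have h0D : coeff 0 (PowerSeries.invOfUnit formalDeltaUnit 1) = 1 := by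
    rw [coeff_zero_eq_constantCoeff_apply, constantCoeff_invOfUnit, inv_one, Units.val_one]
  rw [formalXJ, coeff_two_mul, h0E, h0D, coeff_one_formalE4_pow_three, coeff_two_formalE4_pow_three,
    coeff_one_invOfUnit_formalDeltaUnit, coeff_two_invOfUnit_formalDeltaUnit]
  norm_num

/-- `2 ∣ 196884 = c(1)`: the form consumed by the `2`-adic reading of the Tate unit.
[cite: NesterenkoPhilippon2001, Ch. 2, Prop. 2.1] -/
theorem two_dvd_coeff_two_formalXJ : (2 : ℤ) ∣ coeff 2 formalXJ := by
  rw [coeff_two_formalXJ]; norm_num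

/-- `8 ∣ 744`, the constant coefficient of `J(z) − 1/z`. [cite: NesterenkoPhilippon2001, Ch. 2, Prop. 2.1] -/
theorem eight_dvd_coeff_one_formalXJ : (8 : ℤ) ∣ coeff 1 formalXJ := by
  rw [coeff_one_formalXJ]; norm_num

end Literature.NumberTheory.EllipticCurves

end
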